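import Mathlib
import HarnessLib
import HarnessLib.Audit
import Summits.RiemannHypothesis.Statement
import Literature.NumberTheory.LFunctions.WeilExplicit
import Literature.NumberTheory.LFunctions.ZetaScrewThm12Proofs
import Literature.Analysis.InverseSpectral.KreinString
import Literature.Analysis.InverseSpectral.HelicalFunction
import Summits.RiemannHypothesis.RiemannHypothesis.Theorems.WeilPosWeilposRungPrime2
import HarnessLib.Audit.Status.Attr

/-!
Route: PluckedString

DORMANT since 2026-08-29T21:02:58Z (census g0: costume (trib-confirmed census-trib-costume-B 2026-08-29; 21-frontier 19:16:23Z (b)); reversible --off) — unstaffed, not closed; items shared with open routes are served there. `ledger route dormant <id> --off` reactivates.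

# Route PluckedString — the zeta string exists and is an archimedean wall plucked at the
half-logarithms of the prime powers

It suffices to show X (card RiemannHypothesis/RiemannHypothesis/plucked-zeta-string): Suzuki's
prime-side function Ψ (Suzuki2023 (1.1): Ψ(t) = 4(e^{t/2}+e^{-t/2}-2) - Σ_{n ≤ e^t} Λ(n) n^{-1/2}(t
- log n) + (t/2)[ψ(1/4) - log π] + (1/4)(C - e^{-t/2}Φ(e^{-2t},2,1/4)), even extension; in the tree
`Literature.NumberTheory.LFunctions.zetaScrew`, by `rfl` the inline Ψ below; Ψ'' = the Weil
distribution = Kreĭn's accelerant, Suzuki2023 §3.5) is minus a Kreĭn screw (helical) function on ℝ: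
the kernel G(t,u) = Ψ(t)+Ψ(u)-Ψ(t-u) is positive semidefinite on every finite configuration. By
Kreĭn's representation theorem (ArovDym2012 Thm 9.1) X says that Ψ is the transition function of an
honest Kreĭn string — Kotani's zeta string S[m_ξ, L_ξ] with Weyl function q_ξ(z) = Σ_{γ>0} 2/(γ²-z),
b = 0 (Suzuki2023 §9 p.20, Kotani2021) EXISTS with non-negative mass — and X ⇔ RH (Suzuki2023 Thm
1.2). The route's content is the STRUCTURE of that string at finite depth: an analytic archimedean
wall carrying impedance reflectors (isolated singularities of the mass density read in travel time
τ; by the renormalised law EchoAmplitudes they are inverse-log SMEARED steps of size Λ(n)n^{-1/2},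
because the end is log-degenerate, Y(ω) ~ ½log ω — the competing jump reading is kept on record) at
τ = (log n)/2 for the prime powers n, plus the strictly milder compensators that layer stripping
forces on the ECHO CLOSURE of that comb: surface echoes land on the integer comb (log is additive),
but internal reverberations land at half-logarithms of RATIONALS — 3→2→3 at τ = ½log(9/2) = 0.75204
first — where Ψ'' is real-analytic, so the medium itself must cancel them (refuter crux-attacks on
CombStructure/EchoAmplitudes, 2026-08-15; rev-4/5 repairs). Below r = 81/16 the echo-closed comb is
the finite set {2, 3, 4, 9/2, 5}; beyond it proliferates (countable closure, not filed). Read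
prime-side by layer stripping and zero-side by exact Stieltjes inversion of 10^4-10^5 zeros.
Lean: `let Ψ : ℝ → ℝ := fun t => 4 * (Real.exp (|t| / 2) + Real.exp (-(|t| / 2)) - 2) - (∑ n ∈
Finset.Icc 1 ⌊Real.exp |t|⌋₊, ArithmeticFunction.vonMangoldt n / Real.sqrt n * (|t| - Real.log n)) -
|t| / 2 * (Real.eulerMascheroniConstant + Real.pi / 2 + 3 * Real.log 2 + Real.log Real.pi) + (1 / 4)
* ((∑' k : ℕ, 1 / ((k : ℝ) + 1 / 4) ^ 2) - Real.exp (-(|t| / 2)) * ∑' k : ℕ, Real.exp (-(2 * |t| *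
k)) / ((k : ℝ) + 1 / 4) ^ 2); ∀ (N : ℕ) (t x : Fin N → ℝ), 0 ≤ ∑ i, ∑ j, (Ψ (t i) + Ψ (t j) - Ψ (t i
- t j)) * (x i * x j)`

## Assembly
Deciding theorem (D-0027 §2.1, certified): `closes : StringThesis → Summit.RiemannHypothesis`,
through PROVED tree facts only — Suzuki2023 Thm 1.2 is discharged in the tree as
`Literature.NumberTheory.LFunctions.Suzuki2023_thm12_holds` (ZetaScrewThm12Proofs.lean: RH → kernel
PSD by the real form of Suzuki2023 (1.9); kernel PSD → Ψ ≥ 0 (one-point configurations) → RH by Thm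
1.7 / Landau, ZetaScrewThm17Proofs.lean), and `Suzuki2023_thm12.iff_real` is exactly X because
`zetaScrew_def` / `zetaScrewKernel_def` (ZetaScrew.lean) are `rfl` to the inline Ψ. No
Weil-criterion constant is used: the open conjecture `WeilPositivity` (WeilExplicit.lean, ≡ RH by
`weil_criterion_holds`) is neither an item nor a dependency of this route; WeilExplicit.lean stays
imported only because `IsWeilTest` / `weilQuadratic` / `WeilPositivityOn` (FirstKink, FirstPluck,
PsiWeilIdentity, ScrewToWeilOn) live there. The second road X → (ScrewToWeilOn) ∀ a,
WeilPositivityOn a → RH (`uniformWeilPositivity_iff_weilPositivity`, `weil_criterion_holds`) remains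
available but is not the glue. The cruxes FirstKink/FirstPluck/CombStructure/EchoAmplitudes (and the
supports StringSegment, FreeEndSeries, typed over `Literature.Analysis.InverseSpectral.KreinString`)
are the structural route TO X, not hypotheses of `closes`.

Rationale: WHY THIS LINE. Imports Kreĭn's inverse spectral theory of strings and his helical/accelerant
extension problems (DymMcKean1976 ch. 5-6; ArovDym2012 ch. 9, 12), one-dimensional inverse
scattering (Goupillaud exact layer stripping and propagation of singularities: BubeBurridge1983,
Symes1983), Suzuki's screw function (Suzuki2023) and Kotani's zeta string (Kotani2021), with the
explicit dictionary Weil distribution Ψ'' ↔ accelerant/impulse response, Ψ ↔ transition function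
(step response of the free end; tree: KreinString.transitionFunction, which is built from σ_S and
forgets the Weyl constant b, hence the normalisation 'no initial massless gap' = Kotani's b = 0 in
every string-side item), explicit-formula time t ↔ twice the travel time, prime power n ↔ reflector
at τ = (log n)/2, multiple scattering ↔ the MULTIPLICATIVE BOUNCE CLOSURE of the prime powers (a
returning broken ray with down-turns d_i at reflectors and up-turns u_i at shallower reflectors or
the surface arrives at two-way time log(Πd_i/Πu_i): surface echoes give integers, internal
reverberations give rationals, 9/2 = 3·3/2 first — the card's 'Dirichlet convolution / log is
additive' heuristic counted surface echoes only), WeilPositivityOn a ↔ the depth-a segment has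
non-negative mass (ScrewToWeilOn, PsiWeilIdentity = Suzuki2023 Prop 3.1 typed against the tree), RH
↔ the segment never ties (Suzuki2023 Thm 1.2/1.4). Retired neighbours (cards
loewner-stieltjes-at-s-equals-2, verblunsky-cmv-canonical-hilbert-polya) show that 'RH ⇔ q_ξ
Stieltjes / Schur non-explosion' alone is a costume, so the typed spine (X, FirstPluck) is declared
known-equivalent material and the cruxes carry the new content: FirstKink (typed: Kreĭn's coordinate
turns a corner exactly when the prime 2 arrives), then the comb-structure FRAME CombStructure #4
(refuted-misstated on the INTEGER comb — internal multiples return at logs of rationals, 3v2^3 at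
log(9/2) — and RESTATED rev 6, typed over Literature.Analysis.InverseSpectral.KreinString /
zetaScrew on the echo-closed comb E = ½log{2,3,4,9/2,5} with depth cap a ≤ ½log(81/16), neutral on
the type of the singularities) and the RENORMALISED echo-amplitude law EchoAmplitudes #5 (typed
2026-08-15 after two refuted-misstated verdicts: the log-singular free end, Ψ'(0+) = +∞ ⇔ Z(0+) = 0
⇔ admittance Y(s) = (ξ'/ξ)(1/2+s) ~ (1/2)log s, filters every echo by 2Y ≍ log ω, so the clean steps
of Ψ' force effective reflection coefficients r_n(ω) = −Λ(n)n^{-1/2}/(2Y(ω)) → 0: no impedance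
jumps, inverse-log smeared steps, Born exact at leading type, law linear in Λ(n)n^{-1/2}), plus the
exact zero-side reconstruction experiment (support ZeroSideComb, kit protocol) and the
wall-ties-at-finite-depth calibration (support ArchWallDepth). Finite propagation speed makes every
depth-a statement involve only n ≤ e^{2a}, so the first cruxes are unconditional or rung-conditional
analysis that meshes with route WeilPos rung by rung (FirstPluck IS stmt-RiemannHypothesis-0100 by
dedup). The bet for RH itself: comb structure (reflection data controlled by Λ(n)/√n against an
explicit wall) is a handle on non-degeneracy that abstract positivity lacks, and the experiment can
sharpen X into a closed-form prime-side profile whose forward spectral identity is checkable depth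
by depth (constructive Hilbert–Pólya).

RANKED CRUXES. #0 StringThesis (target) — -Ψ is a Kreĭn screw function on ℝ (kernel Ψ(t)+Ψ(u)-Ψ(t-u)
PSD on finite configurations) = the zeta string exists; Suzuki2023 Thm 1.2 face of RH. (why it might
fail: false iff RH is false (Suzuki2023 Thm 1.2); no margin: lim inf Ψ = 0 conjecturally (Suzuki2023
§7.1), first-pluck window margin < 6e-8 (arXiv:2106.01715 §2.3) — NewmanConjecture barrier applies.)
[Suzuki2023, ArovDym2012, Kotani2021, arXiv:2106.01715]
#2 FirstKink (crux) — Kreĭn's coordinate of the zeta string at travel depth a — the Christoffel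
function of λ = 0, A(a) := sup over Weil tests f supported in [-a,a] of 2 Re ∫f - W(f⋆f̃) (=
⟨T_a^{-1}1,1⟩; up to the free-end normalisation the mass m_ξ(x(a)) or the position x(a), so A' is
the impedance^±1 in travel time) — is real-analytic on the wall 0 < a < (log 2)/2 and, granted
WeilPositivityOn((log 3)/2), real-analytic on ((log 2)/2,(log 3)/2) but NOT analytic at a = (log
2)/2: the first reflector (n = 2, delta of strength Λ(2)/√2 in Ψ'' at t = log 2 entering the window
at 2a = log 2) leaves a corner. Typed spearhead of the comb-structure theorem (card C1); the 'bold
form' (one-sided derivatives differ = impedance jump) is RETIRED by EchoAmplitudes' renormalisation: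
A is predicted C¹ at (log 2)/2 with A' = Z not Dini-continuous there (inverse-log smeared step),
still non-analytic. [difficulty: L] (why it might fail: the log-singular free end (Ψ'' ~ -1/(2t) at
0+, Kotani m ~ 4x/log²x) could make A non-analytic everywhere or smooth the reflector into a
C^∞-but-Gevrey feature; and 'analytic along the wall' needs analytic dependence of Kreĭn's resolvent
on the window.) [Suzuki2023, Kotani2021, ArovDym2012, DymMcKean1976, BubeBurridge1983, Symes1983]
#3 FirstPluck (crux) — the string survives its first pluck: Weil positivity for tests supported in
[-(log 3)/2, (log 3)/2] (window containing exactly one reflector, n = 2). Same statement as route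
WeilPos crux stmt-RiemannHypothesis-0100 (dedup intended); this route adds the attack 'certified
Kreĭn/Gopinath–Sondhi continuation of the explicit accelerant across one reflector' (a Volterra-type
computation) instead of a ground-energy lower bound, and needs it as the hypothesis of FirstKink.
[difficulty: L] (why it might fail: RH-implied, so false only with RH; as a target the float margin
at this window is < 6e-8 and the sign flips at p = 2 ± 5e-4 (arXiv:2106.01715 §2.3): any certificate
must resolve 1e-8.) [Yoshida1992, Bombieri2000Weil, arXiv:2106.01715, ConnesConsani2021, Suzuki2023]
#4 CombStructure (crux; stmt-RiemannHypothesis-2687 RESTATED rev 6, typed = the refuters' frame C′₂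
made neutral on the type of the teeth) — for 0 < a ≤ ½log(81/16) = 0.81093 and ANY Kreĭn string S
without initial massless gap whose transition function is Ψ on [0, 2a] (exists: support
StringSegment): on the segment of travel depth < a the mass measure is absolutely continuous with a
positive density d that is real-analytic at every point whose travel time is NOT in E = {½log2,
½log3, log2, ½log(9/2), ½log5} = {0.34657, 0.54931, 0.69315, 0.75204, 0.80472}, and at each point of
E the density is locally bounded above and away from 0 (passable tooth) and GENUINELY singular — no
function analytic at the point agrees with d on a punctured neighbourhood (cheat-proof form). So the
singular support of Z in travel time below depth 0.81 is exactly E: reflectors at the prime powers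
2, 3, 4, 5 and the echo-forced compensator at 9/2 (unique internal ray 3v2^3), nowhere else; whether
the teeth are inverse-log smeared steps (#5) or jumps (competing frame) is NOT asserted here — #5
cites exactly this frame ('Z analytic off E_a'). The refuted rev-1 wording (integer comb X_a, any
depth, jumps, endpoint series) stays on the item's record; its clause (iii) is now the support
FreeEndSeries. (why it might fail: the log-degenerate corner (Y(ω) ~ ½log ω) couples every echo; if
its transfer is non-local in depth it could spread singular SUPPORT off E or ruin analyticity near x
= 0; 'no singular continuous part of dm' and analyticity between teeth need Kreĭn continuation for a
non-L¹ accelerant.) [Suzuki2023, Kotani2021, ArovDym2012, DymMcKean1976, BubeBurridge1983,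
Symes1983, Sierra2014; evidence CombStructure-crux-attack(-g2).md, comb_census.py, planner
repair_memo_v2.md]
#5 EchoAmplitudes (crux, typed) — renormalised echo-amplitude law on Kreĭn's coordinate A (A' = Z),
granted WeilPositivityOn((log 5)/2): with Q_τ(ε) = log(1/ε)·(A(τ+ε) − 2A(τ) + A(τ−ε))/(A(τ+ε) −
A(τ−ε)) (normalisation-free), Q_{(log n)/2}(ε) → c·Λ(n)n^{-1/2} for n = 2, 3, 4 with one c > 0
(predicted c = 1: 0.490, 0.634, 0.347) and Q_{(log 9/2)/2}(ε) → 0: impedance rises through each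
prime-power depth by an inverse-log smeared step of renormalised strength Λ(n)n^{-1/2} (linear law,
prime powers carry their own leading reflector), only milder singularities off the prime powers.
Competing scenario on record: the refuters' jump frame C′ (Q → +∞). [difficulty: L] (why it might
fail: the factorisation return = 2Y(ω)·r_n(ω) through the log-degenerate end is physical optics, not
a theorem; c may depend on n; A may fail to be C¹ off τ = 0; sSup-junk without boundedness.)
[Suzuki2023, Kotani2021, Kasahara1975, KacKrein1974, DymMcKean1976, BubeBurridge1983, Symes1983,
Sierra2014]
#9 StringSegment (support, NEW rev 6 — the 'by Kreĭn's representation/extension theorem there is a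
unique string segment' sentence of rev-1 CombStructure, separated as known material; the non-vacuity
of #4 and FreeEndSeries) — if -Ψ is a screw function on (-2a, 2a) (IsScrewFunctionOn a:
unconditional for small a by Suzuki2023_thm42_screw_holds, for all a under RH by
Suzuki2023_thm12_holds) then some Kreĭn string without initial gap has transition function Ψ on [0,
2a] (KreinHelicalRepresentation_holds + real/even symmetrisation + fold μ ↦ μ² +
krein_theorem_part_three + Stieltjes data uniqueness + strip the gap — all in tree). [difficulty: M]
[ArovDym2012 Thm 9.1, DymMcKean1976 §6, Tomisaki1988 §4, Suzuki2023 §9]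
#9 FreeEndSeries (support, NEW rev 6 = clause (iii) of rev-1 CombStructure; the typed form of the
TWO-LAYER PLAN's EndpointLemma) — for any such S: m(x) = 4x/log²(1/x)·(1 + Σ_{k≥1} c_k/log^k(1/x))
as an asymptotic series at x → 0+ (c₀ = 1 is Kotani's theorem under RH, Suzuki2023 §9 p.20; RH-free
by finite propagation speed: on (0, log 2) exactly Ψ = A(t) - ½ t log(2t) with A real-analytic on
(-π, π), so Ψ'' = -1/(2t) + analytic and Y(ω) ~ ½log ω — the end filter of #5). [difficulty: M]
[Kotani2021, Suzuki2023, DymMcKean1976, KacKrein1974]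
#9 PsiWeilIdentity (support) — Suzuki2023 Prop 3.1 in the tree's normalisation, unconditional: for
every Weil test g, weilQuadratic g = ∫∫ (Ψ(t)+Ψ(u)-Ψ(t-u)) g'(u) conj g'(t) du dt (zero-side via
explicit_formula_holds + Suzuki Thm 1.1(2), or prime-side by two integrations by parts: Ψ'' =
2cosh(t/2) - Σ Λ(n)n^{-1/2}δ_{log n} - e^{t/2}/(2 sinh t) on t > 0 matches weilFunctional's
densities, checked by the planner). [difficulty: M] [Suzuki2023, Bombieri2000Weil]
#9 ScrewToWeilOn (support) — window dictionary (rung ↔ depth): kernel positivity on |t| ≤ a implies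
WeilPositivityOn a (PsiWeilIdentity + Riemann sums; real-vector PSD suffices since the kernel is
real symmetric). [difficulty: provable-now] [Suzuki2023, ArovDym2012]
#9 ScrewConverse (support) — calibration RH → X (Suzuki2023 Thm 1.2 easy direction: under RH the
kernel equals Σ_γ (e^{iγt}-1)(e^{-iγu}-1)/γ² with real γ, via the explicit formula for the triangle
test Δ_t, Suzuki2023 §3.4). [difficulty: M] [Suzuki2023]

TWO-LAYER PLAN. Foreseen once FirstKink closes: CombStructure ⇐ (CornerTransfer, RH-free and
explicit: for the prime-free wall — the string of Ψ restricted to [0, log 2), where exactly Ψ(t) =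
A(t) - ½ t log(2t) with A real-analytic on (-π, π) by Erdélyi's expansion Φ(e^{-u},2,a) = e^{au}[u
log u + B(u)] (the factor e^{-t/2} of Suzuki2023 (1.1) cancels e^{au}, u = 2t, a = ¼; checked
numerically), so the corner datum is Ψ'' = -1/(2t) + analytic — the maps 'up-going front at depth ε
↦ surface trace' and 'surface impulse ↦ down-going field at depth ε' are convolutions with kernels
real-analytic off t = 0: the end filter 2Y(ω) ≍ log ω of #5 changes singularity TYPE but keeps
singular SUPPORTS on the characteristic lattice) → (PropagationLemma: for an accelerant
real-analytic on (0, 2a) off finitely many delta times over such a corner, the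
Kreĭn–GLM/Gopinath–Sondhi continuation has impedance real-analytic off the half-times of the BOUNCE
CLOSURE of the delta set and genuinely singular wherever the closure's budget is non-zero) →
CombStructure; k = 2. FreeEndSeries is the typed EndpointLemma (Kotani-type expansion at the
log-singular end — load-bearing for #5's renormalisation). Once FirstPluck closes: NextPlucks ⇐
windows (log 4)/2, (log 5)/2 by the same certified continuation. k ≤ 3, depth 1; nothing filed now.

KILL CRITERIA. (i) Kit run of ZeroSideComb at N = 10^4 and 3·10^4 shows NO stable localised feature
near τ = 0.347, 0.549, 0.693, 0.752, 0.805 AND a refuter proves FirstKink false (A analytic through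
(log 2)/2): the comb picture is dead — re-pose once in the canonical-system (Hamiltonian)
normalisation (Lagarias2006/Suzuki) before `close --reason refuted:FirstKink`. (ii) FirstPluck
refuted (certified negative direction) refutes RH itself. (iii) If grounders show every string-side
statement reduces verbatim to WeilPos rungs and no KreinString definition is typable within two
librarian passes, close as superseded by route-RiemannHypothesis-WeilPos, migrating
PsiWeilIdentity/ScrewToWeilOn to Literature. (iv) EchoAmplitudes: the kit decider (CHEAPEST
FALSIFIER) showing k_2(D) → const ≠ 0 sends the item back to the refuters' jump frame C′ (re-file
BoldFirstKink / PrimeRatioLaw / PrimeSignLaw, W.lean), while k_2(D)·log(1/D) → 0 (the reflector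
milder than leading type) or a theorem that the leading singularities of Z are not at the
prime-power depths kills the amplitude reading and demotes the line to 'structure census'. (v)
CombStructure: a theorem or a resolution-stable computation showing singular SUPPORT off E below
depth 0.81 (an extra tooth), or the 9/2 compensator absent (prime-side exact layer stripping
currently shows it at -1.25e-3, resolution-stable over 16×), refutes the frame substantively — then
only the 'structure census' of FirstKink survives; (vi) a second ray reaching log 3, log(9/2) or log
5 below depth ½log(81/16), or a forced tooth below 81/16 outside {2,3,4,9/2,5} (exact Diophantine
enumeration), means rev 6 is misstated again — restate once more only with the enumeration attached,
else close.

NOT DECOMPOSED YET. No far-field item (drift of log-impedance vs (ψ(x)-x)/√x, where RH-strength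
meets PNT error terms; tree: riemannHypothesis_iff_chebyshevPsi_isBigO); no closed-form 'comb
string' forward identity (waits for the experiment); no canonical-system / de Branges (E = A - iB)
face; no Davenport–Heilbronn control item beyond the protocol line in ZeroSideComb; no negative-side
item (a tied depth a* = finitely many primes producing an isotropic vector is card
negative-index-krein-langer's territory); no Sierra2014 moving-mirror comparison; no higher windows
(log 4)/2, (log 5)/2; no typed item for the competing jump frame C′ (refuter W.lean cores;
string-side versions r₃(1-r₂²)Λ₂ = r₂Λ₃, r_{9/2}(1-r₃²)(1-r₄²) = r₂r₃², r₅Π(1-r_m²)Λ₂ = r₂Λ₅ with r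
from one-sided mass derivatives are typed in the 2687 repair unit's folder) — deliberately, pending
the decider; no general-depth comb (analytic + summable singular part on the countable echo closure,
which proliferates beyond 81/16: GP 5·(81/80)^k, 64 labels at e^{2a} = 5.4, no finite fixpoint from
5.42 on; local finiteness open).

CHEAPEST FALSIFIER. Discretise the Kreĭn continuation prime-side across the FIRST reflector only
(kit, minutes; refuter g2-2687's comb_census.py already does Levinson/Schur stripping of the
discretised accelerant at two-way steps D = 1e-3 … 1.25e-4): read the Schur parameter k_2(D) at the
log 2 cell for D = 1e-3, 5e-4, 2.5e-4, 1.25e-4, 6e-5, 3e-5. A sharp feature at every D whose product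
k_2(D)·log(1/D) is flat ≈ 0.49·c confirms FirstKink + EchoAmplitudes (the aliased zero density is a
white floor ∝ D log(1/D) in the innovations); k_2(D) flat refutes EchoAmplitudes as restated (jump
frame wins); NO feature at the log 2 cell at any D kills FirstKink and the comb reading at once. For
CombStructure the same stripping at 2a ≤ 1.62 must show sharp features exactly at two-way {log 2,
log 3, log 4, log 9/2, log 5} and nothing else, resolution-stably (refuter g2 at 2a = 1.88: exactly
{log 2,3,4,5,6} ∪ {log 9/2, 16/3, 25/4}). Not run from this seat (hub compute-free for planners;
first task of ZeroSideComb/ArchWallDepth).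

NUMBERS. L_ξ = 2Σ_{γ>0} γ^{-2} = 0.0462 (string length; Suzuki2023 §7.1 gives sup Ψ ≤ 2Σγ^{-2} <
0.094 with all γ); reflector depths τ_n = (log n)/2 = 0.3466, 0.5493, 0.6931, 0.8047, 0.9730, 1.0397
(n = 2,3,4,5,7,8); first-order strengths Λ(n)/√n = 0.490, 0.634, 0.347, 0.720, 0.735, 0.245; zeros
of Ψ' on [0, log 2): 0.1526, 0.4640, Ψ(0.4640) = 0.03966 (Suzuki2023 Thm 4.1); Kotani: m_ξ(x) ~
4x/log²x at the free end; archimedean rung a ≤ (log 2)/2 proved in tree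
(weilPositivityOn_log_two_half_holds); margin at e^L = 3: < 6e-8 (arXiv:2106.01715 §2.3); end
filter: Y(s) = (ξ'/ξ)(1/2+s) = (1/2)log(s/2π) + o(1), Ψ'(t) = (1/2)log(1/t) + O(1); renormalised
predictions Q → Λ(n)/√n = 0.490, 0.634, 0.347, 0.720 (n = 2,3,4,5), smeared step log Z(τ_n+ε) − log
Z(τ_n−ε) ≈ 2Λ(n)n^{-1/2}/log(1/ε); witness depths (log 9/2)/2 = 0.75204, (log 16/3)/2 = 0.83699;
echo closure below 5 = {2,3,4,9/2}, below 81/16 = {2,3,4,9/2,5} (orders 1,1,1,3,1), cap ½log(81/16)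
= 0.81093 (81/16 = (9/2)²/4, order 7, first proliferation point; next 16/3, 50/9, 45/8, 256/45,
160/27, 6); corner: Ψ(t) = A(t) - ½ t log(2t) on (0, log 2), A real-analytic on (-π, π); Kotani b =
0 (Suzuki2023 §9 p.20).

DEFINITION REQUESTS. Both rev-1 requests have LANDED:
Literature.Analysis.InverseSpectral.KreinString (KreinString, mass, dom, massMeasure, travelTime,
transitionFunction, truncate; KreinStringFundamentalSystem_holds, krein_theorem_part_three;
uniqueness (ii) of KreinInverseSpectralTheorem still a fact) with HelicalFunction.lean
(IsScrewFunctionOn, KreinHelicalRepresentation_holds, helicalExtension_exists), and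
Literature.NumberTheory.LFunctions.ZetaScrew (zetaScrew = the inline Ψ by rfl, zetaScrewKernel;
Suzuki2023 Thm 1.1(2), 1.2, 1.7, 4.2 proved). Still useful (not blocking): a named prime-free Ψ_∞ :=
zetaScrew - zetaScrewPrimeSum for ArchWallDepth, and the Tomisaki identification weylConstant =
inf{x > 0 : m(x) > 0}.

Novelty: NOVELTY (searched this session before claiming: lit read arXiv:2206.03682 = Suzuki2023 pp.2-4, 6-8,
16-17, 20-21 (Thms 1.1-1.8, Prop 3.1, §3.4-3.5, Thm 4.1, §9, §10); lit read arXiv:1404.4252 =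
Sierra2014 abstract + §3; lit read book ArovDym2012 (doi:10.1017/cbo9781139093514) §§1.14-1.16, 9.1,
9.3 (Thm 9.1, 9.14, accelerant classes); lit search zbMATH "Krein string Riemann zeta" (1 row:
LangerWinkler1998, generalized strings, no zeta); lit galaxy search --star all "zeta function and
Krein's string" (0), galaxy pdf title 'string' + "inverse spectral problem" (10 rows, none on zeta);
crossref: BubeBurridge1983 doi:10.1137/1025122, Symes1983 doi:10.1016/0022-247x(83)90072-0; lit
frontier RiemannHypothesis --since 2022 (arXiv:2509.18963 on Re ξ'/ξ > 0, Lagarias-criterion side;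
nothing on strings); lit bridges (nothing relevant); the 125 idea cards
(negative-index-krein-langer: same objects, Pontryagin index, no inverse problem; loewner-stieltjes
and verblunsky-cmv retired as costumes — avoided here); two refuter novelty audits of the card
(08:20Z, 10:45Z). Kotani2021 (ResearchGate 348522988) not held: lit want acq-02128.)
Nearest prior art. (1) Suzuki2023: Ψ, RH ⇔ -Ψ screw (Thm 1.2), Prop 3.1 (our PsiWeilIdentity), one
sentence '§3.5: W is an accelerant of g in the sense of KrLa85', §9 existence of the zeta string
under RH + Kotani's endpoint asymptotic — NO statement on the structure of m_ξ away from 0, no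
finite-depth prime-side segments, no reflector reading. (2) Kotani2021 (p  [refs: 10.1017/cbo9781139093514, 10.1137/1025122, 10.1016/0022-247x(83, 2206.03682, 1404.4252, 2509.18963, doi:10.1017/cbo9781139093514, doi:10.1137/1025122, doi:10.1016/0022-247x, Suzuki2023, Sierra2014, ArovDym2012, LangerWinkler1998, BubeBurridge1983, Symes1983, Kotani2021, BerryKeating1999, WuSprung1993, SchumayerHutchinson2011, DymMcKean1976]

Barriers (technique_class: Hilbert-Polya Krein-string inverse-scattering layer-stripping): - technique_class: Hilbert-Polya Krein-string inverse-scattering layer-stripping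
- Literature.Barriers.RiemannHypothesis.ScalingSystemCounting (no power-law counting function
matches N_ζ; proved in tree): EVADED by the object — the zeta string has finite length L_ξ =
2Σγ^{-2} = 0.046 and infinite travel time, its Weyl law N(λ) ~ (√λ/2π) log √λ is built in (Kotani's
4x/log²x end encodes it); the barrier is why the background is a wall, not a box, and ArchWallDepth
uses it as calibration.
- Literature.Barriers.RiemannHypothesis.BerryKeatingOperator (Endres–Steiner: xp has no L²
eigenfunctions / linear Weyl laws on graphs): closer than the card first said (Sierra2014's
background IS xp) but not this class — no xp quantisation is posited; the string is the OUTPUT of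
Kreĭn's inverse theorem from the Weil distribution, with discrete spectrum by construction when it
exists. Any later 'closed-form comb string' item must state its Weyl law explicitly to stay outside.
- Literature.Barriers.RiemannHypothesis.DavenportHeilbronn: bites any claim 'functional equation ⇒
string'. Evaded because every statement is about ζ's Weil distribution, whose prime side has
one-signed Λ(n) ≥ 0 from the Euler product; for DH the analogue of Ψ is not a screw function at
large depth (off-line zeros = negative squares, cf. card negative-index-krein-langer), no string
exists, and DH is written into ZeroSideComb as the CONTROL run (reconstruction must destabilise).
- Literature.Barriers.RiemannHypothesis.Diam

History (route lifecycle, newest last):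
- 2026-08-15T22:04:37Z · rev 4: restated EchoAmplitudes (stmt-RiemannHypothesis-2716) — repair: EchoAmplitudes (stmt-2716) refuted-misstated ×2 (g0 17:00Z, g2 20:14Z; c/κ undefined at the singular end, vacuous polynomial clause, internal multiples (planner-rrefute-RiemannHypothesis-PluckedStrin-9c9fdb4d-0)
- 2026-08-15T22:13:41Z · rev 6: restated CombStructure (stmt-RiemannHypothesis-2687) — repair (route-repair unit rrefute-…-49a5e441; rev 6): CombStructure stmt-2687 refuted-MISSTATED on paper (crux-attacks 16:31Z/20:16Z: internal reverberation 3→2 (planner-rrefute-RiemannHypothesis-PluckedStrin-49a5e441-0)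
- 2026-08-16T04:16:30Z · AUTO-CRUX (backfill): StringThesis — hypotheses of the deciding theorem that nothing in the route derives are cruxes (operator:999:1085951)
- 2026-08-23T11:52:07Z · DORMANT — reconciler: no traction for 6 d (last activity item-evidence-added at 2026-08-17T09:54:39Z); parked, not closed — `ledger route dormant route-RiemannHypothesis- (operator:999:1183174)
- 2026-08-26T06:33:04Z · REACTIVATED — reconciler: reactivated — activity item-evidence-added at 2026-08-26T05:17:54Z after parking at 2026-08-23T11:52:07Z (operator:999:330396)
- 2026-08-29T21:02:58Z · DORMANT — census g0: costume (trib-confirmed census-trib-costume-B 2026-08-29; 21-frontier 19:16:23Z (b)); reversible --off (operator:999:1783800)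

sub-problem: RiemannHypothesis · status: dormant · opened planner-plancard-RiemannHypothesis-RiemannHyp-711bd1fc-0 2026-08-15T11:06:24Z · rev 6 · ledger route-RiemannHypothesis-PluckedString
GENERATED by the gate from the ledger (D-0016/17). Provers cite these decls: `theorem foo : Summit.RiemannHypothesis.RiemannHypothesis.Theses.PluckedString.<Decl> := …` in Summits/RiemannHypothesis/RiemannHypothesis/Theorems/<Name>.lean.
-/

namespace Summit.RiemannHypothesis.RiemannHypothesis.Theses.PluckedString

open scoped BigOperators Topology Manifold Classical MeasureTheory ProbabilityTheory Matrix InnerProductSpace ComplexConjugate ContinuousMap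
open Filter Set Function TopologicalSpace MeasureTheory

attribute [summit_statement] _root_.Summit.RiemannHypothesis

open Summit

/-- item stmt-RiemannHypothesis-2621 · crux (kind.auto-crux: conjecture-grade) · rank 0 · open · by planner
why it might fail: false iff RH is false (Suzuki2023 Thm 1.2); no margin: lim inf Ψ = 0 conjecturally (Suzuki2023 §7.1), first-pluck window margin < 6e-8 (arXiv:2106.01715 §2.3) — NewmanConjecture barrier applies.
sources: Suzuki2023, ArovDym2012, Kotani2021, arXiv:2106.01715
[target] -Ψ is a Kreĭn screw function on ℝ (kernel Ψ(t)+Ψ(u)-Ψ(t-u) PSD on finite configurations) =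
the zeta string exists; Suzuki2023 Thm 1.2 face of RH. -/
@[route_item "route-RiemannHypothesis-PluckedString", crux]
def StringThesis : Prop :=
  let Ψ : ℝ → ℝ := fun t => 4 * (Real.exp (|t| / 2) + Real.exp (-(|t| / 2)) - 2) - (∑ n ∈ Finset.Icc 1 ⌊Real.exp |t|⌋₊, ArithmeticFunction.vonMangoldt n / Real.sqrt n * (|t| - Real.log n)) - |t| / 2 * (Real.eulerMascheroniConstant + Real.pi / 2 + 3 * Real.log 2 + Real.log Real.pi) + (1 / 4) * ((∑' k : ℕ, 1 / ((k : ℝ) + 1 / 4) ^ 2) - Real.exp (-(|t| / 2)) * ∑' k : ℕ, Real.exp (-(2 * |t| * k)) / ((k : ℝ) + 1 / 4) ^ 2); ∀ (N : ℕ) (t x : Fin N → ℝ), 0 ≤ ∑ i, ∑ j, (Ψ (t i) + Ψ (t j) - Ψ (t i - t j)) * (x i * x j)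

/-- item stmt-RiemannHypothesis-2622 · crux · rank 2 · open · by planner
why it might fail: the log-singular free end (Ψ'' ~ -1/(2t) at 0+, Kotani m ~ 4x/log²x) could make A non-analytic everywhere or smooth the reflector into a C^∞-but-Gevrey feature; and 'analytic along the wall' needs analytic dependence of Kreĭn's resolvent on the window.
sources: Suzuki2023, Kotani2021, ArovDym2012, DymMcKean1976, BubeBurridge1983, Symes1983
[crux] Kreĭn's coordinate of the zeta string at travel depth a — the Christoffel function of λ = 0,
A(a) := sup over Weil tests f supported in [-a,a] of 2 Re ∫f - W(f⋆f̃) (= ⟨T_a^{-1}1,1⟩; up to the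
free-end normalisation the mass m_ξ(x(a)) or the position x(a), so A' is the impedance^±1 in travel
time) — is real-analytic on the wall 0 < a < (log 2)/2 and, granted WeilPositivityOn((log 3)/2),
real-analytic on ((log 2)/2,(log 3)/2) but NOT analytic at a = (log 2)/2: the first reflector (n =
2, delta of strength Λ(2)/√2 in Ψ'' at t = log 2 entering the window at 2a = log 2) leaves a corner.
Typed spearhead of the comb-structure theorem (card C1); bold form (one-sided derivatives differ =
impedance JUMP, not cusp) is in EchoAmplitudes. [difficulty: L] -/
@[route_item "route-RiemannHypothesis-PluckedString"]
def FirstKink : Prop :=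
  let A : ℝ → ℝ := fun a => sSup {y : ℝ | ∃ f : ℝ → ℂ, Literature.NumberTheory.LFunctions.IsWeilTest f ∧ tsupport f ⊆ Set.Icc (-a) a ∧ y = 2 * (∫ t : ℝ, f t).re - (Literature.NumberTheory.LFunctions.weilQuadratic f).re}; AnalyticOnNhd ℝ A (Set.Ioo 0 (Real.log 2 / 2)) ∧ (Literature.NumberTheory.LFunctions.WeilPositivityOn (Real.log 3 / 2) → AnalyticOnNhd ℝ A (Set.Ioo (Real.log 2 / 2) (Real.log 3 / 2)) ∧ ¬ AnalyticAt ℝ A (Real.log 2 / 2))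

/-- item stmt-RiemannHypothesis-0100 · crux · rank 3 · closed · proved by Summit.RiemannHypothesis.RiemannHypothesis.Theorems.WeilposRungPrime2_proof @ 93741d75e904 (prover) · by planner
why it might fail: RH-implied, so false only with RH; as a target the float margin at this window is < 6e-8 and the sign flips at p = 2 ± 5e-4 (arXiv:2106.01715 §2.3): any certificate must resolve 1e-8.
sources: Yoshida1992, Bombieri2000Weil, arXiv:2106.01715, ConnesConsani2021, Suzuki2023
First arithmetic rung of the semi-local ladder: for g smooth with tsupport g ⊆ [-(log 3)/2, (log
3)/2], supp(g⋆g̃) ⊆ [-log 3, log 3] so the prime term of W(g⋆g̃) contains exactly the prime power 2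
(terms ± log 2). OPEN; implied by RH (RH → WeilPositivity → this). Connes' semi-local trace formula
for S = {∞, 2} [Connes1999 §VII]; the archimedean rung a ≤ (log 2)/2 is a theorem
[ConnesConsani2021]. Attack: operator-theoretic (compression of scaling action, prolate functions),
variational [Bombieri2000 §§3-5], or certified finite-rank numerics for a lower bound of the ground
energy ε((log 3)/2) ≥ 0. -/
@[route_item "route-RiemannHypothesis-PluckedString"]
def FirstPluck : Prop :=
  Literature.NumberTheory.LFunctions.WeilPositivityOn (Real.log 3 / 2)

/-- `FirstPluck` holds: proved by `Summit.RiemannHypothesis.RiemannHypothesis.Theorems.WeilposRungPrime2_proof` @ 93741d75e904. -/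
theorem FirstPluck_holds : FirstPluck := _root_.Summit.RiemannHypothesis.RiemannHypothesis.Theorems.WeilposRungPrime2_proof

-- earlier CombStructure (stmt-RiemannHypothesis-2687, replaced 2026-08-15T22:13:41Z -> stmt-RiemannHypothesis-13892): retired by None — [crux] COMB STRUCTURE THEOREM (finite depth, prime-side; general form of FirstKink; card plucked-zeta-string C1). Needs definition KreinString (requested). Let a > 0 be a depth at which -Ψ restricted to (-2a, 2a) is helical (kernel Ψ(t)+Ψ(u)-Ψ(t-u) PSD for |t|,|u| <
/-- item stmt-RiemannHypothesis-13892 · crux · rank 4 · open · by planner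
why it might fail: The log-degenerate corner (Y(ω)∼½log ω) couples every echo; if its transfer is non-local in depth it could spread singular SUPPORT off E or ruin analyticity near x = 0; 'no singular continuous part of dm' and analyticity between teeth need Kreĭn continuation for a non-L¹ accelerant.
sources: Suzuki2023, Kotani2021, ArovDym2012, DymMcKean1976, BubeBurridge1983, Symes1983
[crux] COMB STRUCTURE THEOREM — REPAIRED (rev 5; frame C′₂ of the refuter crux-attacks
2026-08-15T16:31Z / 20:16Z on this item, made NEUTRAL on the nature of the teeth after the
EchoAmplitudes repair stmt-13874). Rev-1 wording 'm′ real-analytic off the INTEGER comb X_a = {(log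
n)/2} at any depth, JUMPS at prime powers' is refuted on paper: the internal reverberation 3→2→3
arrives at two-way t = log(9/2) where Ψ'' (Suzuki2023 (1.1)) is real-analytic, so layer stripping
forces a compensating reflector at τ = ½log(9/2) = 0.75204 ∉ X_a (evidence files on this item).
SETTING: Ψ = zetaScrew (tree); 0 < a ≤ ½log(81/16) = 0.81093; S any Kreĭn string
(Literature.Analysis.InverseSpectral.KreinString) WITHOUT initial massless gap (m(x) > 0 for 0 < x <
L: Kotani's normalisation b = 0, Suzuki2023 §9 p.20 — needed because the tree's transitionFunction
is built from σ_S and forgets the Weyl constant) whose transition function equals Ψ on [0, 2a] (such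
S exists as soon as -Ψ is a screw function on (-2a,2a): support StringSegment; under RH it is
Kotani's zeta string for every a). seg := {x : 0 < x < L, travelTime x < a} (segment of travel depth
a); E := {½log2, ½log3, log2, ½log(9/2), ½log5} = {0.3 -/
@[route_item "route-RiemannHypothesis-PluckedString"]
def CombStructure : Prop :=
  ∀ a : ℝ, 0 < a → a ≤ Real.log (81 / 16) / 2 → ∀ S : Literature.Analysis.InverseSpectral.KreinString, (∀ t ∈ Set.Icc (0 : ℝ) (2 * a), S.transitionFunction t = Literature.NumberTheory.LFunctions.zetaScrew t) → (∀ x ∈ S.dom, 0 < x → 0 < S.mass x) → let E : Set ℝ := {Real.log 2 / 2, Real.log 3 / 2, Real.log 2, Real.log (9 / 2) / 2, Real.log 5 / 2}; let seg : Set ℝ := {x : ℝ | 0 < x ∧ ENNReal.ofReal x < S.length ∧ S.travelTime x < a}; ∃ d : ℝ → ℝ, S.massMeasure.restrict seg = (MeasureTheory.volume.restrict seg).withDensity (fun x => ENNReal.ofReal (d x)) ∧ (∀ x ∈ seg, 0 < d x) ∧ (∀ x ∈ seg, S.travelTime x ∉ E → AnalyticAt ℝ d x) ∧ (∀ x ∈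 seg, S.travelTime x ∈ E → (∃ c C : ℝ, 0 < c ∧ ∀ᶠ y in 𝓝 x, c ≤ d y ∧ d y ≤ C) ∧ ¬ ∃ g : ℝ → ℝ, AnalyticAt ℝ g x ∧ ∀ᶠ y in 𝓝[≠] x, d y = g y)

-- earlier EchoAmplitudes (stmt-RiemannHypothesis-2716, replaced 2026-08-15T22:04:37Z -> stmt-RiemannHypothesis-13874): retired by None — Literature.NumberTheory.LFunctions.WeilPositivityOn (Real.log 5 / 2) → (let A : ℝ → ℝ := fun a => sSup {y : ℝ | ∃ f : ℝ → ℂ, Literature.NumberTheory.LFunctions.IsWeilTest f ∧ tsupport f ⊆ Set.Icc (-a) a ∧ y = 2 * (∫ t : ℝ, f t).re - (Literature.NumberTheory.LFuncti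
/-- item stmt-RiemannHypothesis-13874 · crux · rank 5 · open · by planner
why it might fail: Factorisation return = 2Y(ω)·r_n(ω) through the log-degenerate end is physical optics, not a theorem: c may ≠ 1 or depend on n (kills the ratio clauses), A may fail to be C¹ off τ = 0 (no limit), and A is sSup-junk unless positivity at depth (log 5)/2 bounds the Christoffel problem.
sources: Suzuki2023, Kotani2021, Kasahara1975, KacKrein1974, ArovDym2012, DymMcKean1976
[crux] RENORMALISED ECHO-AMPLITUDE LAW (repaired 2026-08-15 after refuted-misstated ×2; quantitative
content of the comb, card plucked-zeta-string (b); evidence_2716_planner.md). Everything is stated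
on Kreĭn's coordinate A of FirstKink (A(a) = sup{2Re∫f − W(f⋆f̃) : supp f ⊆ [−a,a]} = m_ξ(x(a)) by
Kreĭn's formula, so A' = Z = √(m'∘x) is the impedance in travel time; ArovDym2012 §2.6
(2.63)–(2.67), DymMcKean1976 ch. 6, KacKrein1974), granted Weil positivity at depth (log 5)/2
(RH-implied rung; keeps A finite past the reflectors 2, 3, 4 and the witness depth (log 9/2)/2 =
0.75204, where the echo closure is still finite, {2,3,4,9/2} below 5). With S(ε) = A(τ+ε) − 2A(τ) +
A(τ−ε), F(ε) = A(τ+ε) − A(τ−ε) ≈ 2εZ(τ) and Q_τ(ε) = log(1/ε)·S/F (written −log ε · S/F in the Lean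
term) — normalisation-free, no c, no κ: CLAIM (a) at τ_n = (log n)/2, n = 2, 3, 4: Q_{τ_n}(ε) →
c·Λ(n)n^{-1/2} (ε → 0+) with ONE c > 0, predicted c = 1 (0.490, 0.634, 0.347; parameter-free ratios
1.2941 and 1/√2): the impedance rises through every prime-power depth by an inverse-log SMEARED
STEP, log Z(τ_n+ε) − log Z(τ_n−ε) ≈ 2cΛ(n)n^{-1/2}/log(1/ε) → 0 — NO jump (J_n = 0, A is C¹ at τ_n,
A' not Dini there), the law is -/
@[route_item "route-RiemannHypothesis-PluckedString"]
def EchoAmplitudes : Prop :=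
  Literature.NumberTheory.LFunctions.WeilPositivityOn (Real.log 5 / 2) → (let A : ℝ → ℝ := fun a => sSup {y : ℝ | ∃ f : ℝ → ℂ, Literature.NumberTheory.LFunctions.IsWeilTest f ∧ tsupport f ⊆ Set.Icc (-a) a ∧ y = 2 * (∫ t : ℝ, f t).re - (Literature.NumberTheory.LFunctions.weilQuadratic f).re}; let Q : ℝ → ℝ → ℝ := fun τ ε => -Real.log ε * ((A (τ + ε) - 2 * A τ + A (τ - ε)) / (A (τ + ε) - A (τ - ε))); (∃ c : ℝ, 0 < c ∧ ∀ n ∈ ({2, 3, 4} : Finset ℕ), Filter.Tendsto (Q (Real.log n / 2)) (nhdsWithin 0 (Set.Ioi 0)) (nhds (c * (ArithmeticFunction.vonMangoldt n / Real.sqrt n)))) ∧ Filter.Tendsto (Q (Real.log (9 / 2) / 2)) (nhdsWithin 0 (Set.Ioi 0)) (nhds 0))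

/-- item stmt-RiemannHypothesis-13893 · support · rank 9 · open · by planner
sources: ArovDym2012, DymMcKean1976, Tomisaki1988, Suzuki2023
[support] STRING SEGMENT EXISTS (rev 5; the 'by Kreĭn's representation/extension theorem there is a
unique Kreĭn string segment S_a whose transition function on [0,2a] is Ψ' sentence of rev-1
CombStructure, separated as known material; it is the non-vacuity of CombStructure / EchoAmplitudes
/ FreeEndSeries). If -Ψ (Ψ = zetaScrew) is a screw function on (-2a, 2a) in Suzuki's normalisation
(IsScrewFunctionOn a: kernel Ψ(t)+Ψ(u)-Ψ(t-u) non-negative definite for |tᵢ| < a; unconditional for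
small a by Suzuki2023 Thm 4.2 = Suzuki2023_thm42_screw_holds +
isPosSemidefKernelOn_zetaScrewKernel_iff, for every a under RH by Suzuki2023_thm12_holds), then
there is a Kreĭn string S with no initial massless gap (m(x) > 0 for 0 < x < L) whose transition
function Π_S(t) = ∫(1 - cos √λ t)/λ dσ_S equals Ψ(t) for t ∈ [0, 2a]. PROOF SKETCH (all ingredients
are tree facts or routine): Kreĭn extension of -Ψ|window to G ∈ 𝒢_∞ (KreinHelicalRepresentation /
helicalExtension_exists, ArovDym2012 Thm 9.1, after translating IsScrewFunctionOn a ↔ IsHelicalOn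
with window 2a by the zero-sum reformulation of the kernel); replace G by its real even part (𝒢_∞ is
a cone stable under t ↦ conj G(-t)); Kreĭn's formula wit -/
@[route_item "route-RiemannHypothesis-PluckedString"]
def StringSegment : Prop :=
  ∀ a : ℝ, 0 < a → Literature.Analysis.InverseSpectral.IsScrewFunctionOn (ENNReal.ofReal a) (fun t => -(Literature.NumberTheory.LFunctions.zetaScrew t : ℂ)) → ∃ S : Literature.Analysis.InverseSpectral.KreinString, (∀ x ∈ S.dom, 0 < x → 0 < S.mass x) ∧ ∀ t ∈ Set.Icc (0 : ℝ) (2 * a), S.transitionFunction t = Literature.NumberTheory.LFunctions.zetaScrew t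

/-- item stmt-RiemannHypothesis-13894 · support · rank 9 · open · by planner
sources: Kotani2021, Suzuki2023, DymMcKean1976, KacKrein1974
[support] FREE-END ASYMPTOTIC SERIES (rev 5 = clause (iii) of rev-1 CombStructure, split off so that
the comb claims and the endpoint claim can be attacked separately). For every a > 0 and every Kreĭn
string S without initial massless gap whose transition function is Ψ = zetaScrew on [0, 2a] (setting
of CombStructure; exists by StringSegment): m(x) = 4x/log²(1/x)·(1 + Σ_{k≥1} c_k / log^k(1/x)) as an
ASYMPTOTIC series at x → 0+, i.e. there are reals c₀ = 1, c₁, c₂, … with m(x)·log²x/(4x) - Σ_{k<K}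
c_k/(-log x)^k = O((-log x)^{-K}) for every K. The leading term is Kotani's theorem m_ξ(x) ~ 4x(log
x)^{-2} (x → 0+) for the zeta string under RH (Suzuki2023 §9 p.20, Kotani2021); by finite
propagation speed the germ of m at 0 depends only on the germ of Ψ at 0, which is the explicit
RH-free elementary function of Suzuki2023 (1.1) without primes (zetaScrew_eq_of_abs_lt_log_two):
Ψ(t) = A(t) - ½ t log(2t) on (0, log 2) with A real-analytic on (-π, π) by Erdélyi's expansion of
Φ(e^{-2t},2,¼) — so Ψ = ½ t log(1/t) + αt + O(t²) and Ψ'' = -1/(2t) + analytic exactly; the full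
series is the Kreĭn–Kac/Kasahara-type Tauberian refinement driven by that onset (impedance Z(τ) ≈
2/log(1/τ) → 0: the end -/
@[route_item "route-RiemannHypothesis-PluckedString"]
def FreeEndSeries : Prop :=
  ∀ a : ℝ, 0 < a → ∀ S : Literature.Analysis.InverseSpectral.KreinString, (∀ t ∈ Set.Icc (0 : ℝ) (2 * a), S.transitionFunction t = Literature.NumberTheory.LFunctions.zetaScrew t) → (∀ x ∈ S.dom, 0 < x → 0 < S.mass x) → ∃ c : ℕ → ℝ, c 0 = 1 ∧ ∀ K : ℕ, (fun x : ℝ => S.mass x * Real.log x ^ 2 / (4 * x) - ∑ k ∈ Finset.range K, c k / (-Real.log x) ^ k) =O[𝓝[>] (0 : ℝ)] (fun x : ℝ => ((-Real.log x) ^ K)⁻¹)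

/-- item stmt-RiemannHypothesis-2623 · support · rank 9 · closed · proved by Summit.RiemannHypothesis.RiemannHypothesis.Theorems.PsiWeilIdentity_proof (prover) · by planner
sources: Suzuki2023, Bombieri2000Weil
[support] Suzuki2023 Prop 3.1 in the tree's normalisation, unconditional: for every Weil test g,
weilQuadratic g = ∫∫ (Ψ(t)+Ψ(u)-Ψ(t-u)) g'(u) conj g'(t) du dt (zero-side via explicit_formula_holds
+ Suzuki Thm 1.1(2), or prime-side by two integrations by parts: Ψ'' = 2cosh(t/2) - Σ
Λ(n)n^{-1/2}δ_{log n} - e^{t/2}/(2 sinh t) on t > 0 matches weilFunctional's densities, checked by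
the planner). [difficulty: M] -/
@[route_item "route-RiemannHypothesis-PluckedString"]
def PsiWeilIdentity : Prop :=
  let Ψ : ℝ → ℝ := fun t => 4 * (Real.exp (|t| / 2) + Real.exp (-(|t| / 2)) - 2) - (∑ n ∈ Finset.Icc 1 ⌊Real.exp |t|⌋₊, ArithmeticFunction.vonMangoldt n / Real.sqrt n * (|t| - Real.log n)) - |t| / 2 * (Real.eulerMascheroniConstant + Real.pi / 2 + 3 * Real.log 2 + Real.log Real.pi) + (1 / 4) * ((∑' k : ℕ, 1 / ((k : ℝ) + 1 / 4) ^ 2) - Real.exp (-(|t| / 2)) * ∑' k : ℕ, Real.exp (-(2 * |t| * k)) / ((k : ℝ) + 1 / 4) ^ 2); ∀ g : ℝ → ℂ, Literature.NumberTheory.LFunctions.IsWeilTest g → Literature.NumberTheory.LFunctions.weilQuadratic g = ∫ t : ℝ, ∫ u : ℝ, ((Ψ t + Ψ u - Ψ (t - u) : ℝ) : ℂ) * (deriv g u * (starRingEnd ℂ) (deriv g t))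

-- `PsiWeilIdentity` holds: proved by `Summit.RiemannHypothesis.RiemannHypothesis.Theorems.PsiWeilIdentity_proof` (its module imports this route file, so no `_holds` link can be stated here).

/-- item stmt-RiemannHypothesis-2624 · support · rank 9 · closed · proved by Summit.RiemannHypothesis.RiemannHypothesis.Theorems.screwToWeilOn_proof (prover) · by planner
sources: Suzuki2023, ArovDym2012
[support] window dictionary (rung ↔ depth): kernel positivity on |t| ≤ a implies WeilPositivityOn a
(PsiWeilIdentity + Riemann sums; real-vector PSD suffices since the kernel is real symmetric).
[difficulty: provable-now] -/
@[route_item "route-RiemannHypothesis-PluckedString"]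
def ScrewToWeilOn : Prop :=
  ∀ a : ℝ, (let Ψ : ℝ → ℝ := fun t => 4 * (Real.exp (|t| / 2) + Real.exp (-(|t| / 2)) - 2) - (∑ n ∈ Finset.Icc 1 ⌊Real.exp |t|⌋₊, ArithmeticFunction.vonMangoldt n / Real.sqrt n * (|t| - Real.log n)) - |t| / 2 * (Real.eulerMascheroniConstant + Real.pi / 2 + 3 * Real.log 2 + Real.log Real.pi) + (1 / 4) * ((∑' k : ℕ, 1 / ((k : ℝ) + 1 / 4) ^ 2) - Real.exp (-(|t| / 2)) * ∑' k : ℕ, Real.exp (-(2 * |t| * k)) / ((k : ℝ) + 1 / 4) ^ 2); ∀ (N : ℕ) (t x : Fin N → ℝ), (∀ i, |t i| ≤ a) → 0 ≤ ∑ i, ∑ j, (Ψ (t i) + Ψ (t j) - Ψ (t i - t j)) * (x i * x j)) → Literature.NumberTheory.LFunctions.WeilPositivityOn a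

-- `ScrewToWeilOn` holds: proved by `Summit.RiemannHypothesis.RiemannHypothesis.Theorems.screwToWeilOn_proof` (its module imports this route file, so no `_holds` link can be stated here).

/-- item stmt-RiemannHypothesis-2625 · support · rank 9 · closed · proved by Summit.RiemannHypothesis.RiemannHypothesis.Theorems.pluckedStringScrewConverse_proof (prover) · by planner
sources: Suzuki2023
[support] calibration RH → X (Suzuki2023 Thm 1.2 easy direction: under RH the kernel equals Σ_γ
(e^{iγt}-1)(e^{-iγu}-1)/γ² with real γ, via the explicit formula for the triangle test Δ_t,
Suzuki2023 §3.4). [difficulty: M] -/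
@[route_item "route-RiemannHypothesis-PluckedString"]
def ScrewConverse : Prop :=
  Summit.RiemannHypothesis → (let Ψ : ℝ → ℝ := fun t => 4 * (Real.exp (|t| / 2) + Real.exp (-(|t| / 2)) - 2) - (∑ n ∈ Finset.Icc 1 ⌊Real.exp |t|⌋₊, ArithmeticFunction.vonMangoldt n / Real.sqrt n * (|t| - Real.log n)) - |t| / 2 * (Real.eulerMascheroniConstant + Real.pi / 2 + 3 * Real.log 2 + Real.log Real.pi) + (1 / 4) * ((∑' k : ℕ, 1 / ((k : ℝ) + 1 / 4) ^ 2) - Real.exp (-(|t| / 2)) * ∑' k : ℕ, Real.exp (-(2 * |t| * k)) / ((k : ℝ) + 1 / 4) ^ 2); ∀ (N : ℕ) (t x : Fin N → ℝ), 0 ≤ ∑ i, ∑ j, (Ψ (t i) + Ψ (t j) - Ψ (t i - t j)) * (x i * x j))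

-- `ScrewConverse` holds: proved by `Summit.RiemannHypothesis.RiemannHypothesis.Theorems.pluckedStringScrewConverse_proof` (its module imports this route file, so no `_holds` link can be stated here).

-- item stmt-RiemannHypothesis-2747 · support · rank 9 · open · by planner — informal only, no Lean statement yet:
--   [support] ZERO-SIDE RECONSTRUCTION — the experiment carrier (card plucked-zeta-string C2;
--   computations evidence attaches HERE with `ledger workitem evidence <id> --kind computations`). Needs
--   KreinString for the formal statement; conditional on RH only for reading ordinates as real
--   frequencies. For N ≥ 1 let μ_N := Σ_{n ≤ N} 2δ_{γ_n²} + ν_N, where γ_n are the positive zeta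
--   ordinates and ν_N the explicit tail measure with Riemann–von Mangoldt density (1/2π) log(√λ/2π)
--   dλ/√λ beyond γ_N² (smooth cutoff); let S_N be the Stieltjes (discrete Kreĭn) string of μ_N given by
--   the Jacobi recurrence coeffic

-- item stmt-RiemannHypothesis-2758 · support · rank 9 · open · by planner — informal only, no Lean statement yet:
--   [support] THE WALL ALONE TIES AT FINITE DEPTH (calibration; 'the plucks are what keep the string
--   going'). Let Ψ_∞ be the prime-free part of Suzuki's Ψ (drop the Λ-sum in Suzuki2023 (1.1)): the
--   screw-function candidate of the archimedean-and-polar factor s(s-1)π^{-s/2}Γ(s/2), with Ψ_∞'' =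
--   2cosh(t/2) - e^{t/2}/(2 sinh t) on t > 0; Ψ_∞ = Ψ on (-log 2, log 2). Define a_∞* := sup{a : the
--   kernel Ψ_∞(t)+Ψ_∞(u)-Ψ_∞(t-u) is PSD on finite configurations in (-a, a)}. CLAIM: (i) 0 < a_∞* < ∞ —
--   lower bound from Suzuki2023 Thm 4.2 (unconditional positive definiteness for small a; with a
--   certified computatio

/-- item stmt-RiemannHypothesis-2626 · assembly · rank 1 · closed · proved by Summit.RiemannHypothesis.RiemannHypothesis.Theorems.pluckedStringAssembly_proof (prover) · by planner
sources: Suzuki2023, Weil1952, Bombieri2000Weil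
[assembly] StringThesis → the Riemann Hypothesis. -/
@[route_item "route-RiemannHypothesis-PluckedString"]
def Assembly : Prop :=
  StringThesis → Summit.RiemannHypothesis

-- `Assembly` holds: proved by `Summit.RiemannHypothesis.RiemannHypothesis.Theorems.pluckedStringAssembly_proof` (its module imports this route file, so no `_holds` link can be stated here).

/-! D-0027 §2.1 — DECIDING THEOREM (planner-authored via `route open/edit --closes-file`; by planner-rbadge-RiemannHypothesis-PluckedString-e0b8083d-g2-0 2026-08-15T16:18:15Z):
its hypotheses are this route's items and its conclusion the sub-problem Statement (glue_lint), and it elaborates with this file. -/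

@[closes "route-RiemannHypothesis-PluckedString"] theorem closes (hX : StringThesis) : _root_.Summit.RiemannHypothesis :=
  _root_.Summit.RiemannHypothesis_iff.mpr <|
    (Literature.NumberTheory.LFunctions.Suzuki2023_thm12.iff_real
        Literature.NumberTheory.LFunctions.Suzuki2023_thm12_holds).mpr
      fun N t x => hX N t x

end Summit.RiemannHypothesis.RiemannHypothesis.Theses.PluckedString
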